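import Mathlib.MeasureTheory.Integral.Pi
import Literature.NumberTheory.Weil1964.LocalWeilIndex
import HarnessLib

/-!
# Weil's Gauss integrals in several variables: diagonal forms on `Fⁿ` over arbitrary lattices

Topic `NumberTheory/Weil1964`; namespace `Literature.NumberTheory.Weil1964`. KERNEL mathematics only
(plumbing definitions with bodies + theorems; no named fact, no `axiom`, no `sorry`). Sequel of
`LocalQuadraticGaussIntegral.lean` / `LocalWeilIndex.lean` (one variable) and the `n`-variable analogue of
`LocalBinaryGaussIntegral.lean` (two variables): the first file of Weil's n° 25–27 for a quadratic form in
ANY number of variables over a non-archimedean local field `F`.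

Let `μ` be an additive Haar measure on `F`, `μ^⊗ι = Measure.pi (fun _ : ι => μ)` the product Haar measure on
`X = F^ι` (`ι` a finite type), `ψ` a character of conductor exponent `d`, `‖2‖ = q^{-v₂}`, and
`f(x) = Σᵢ cᵢ xᵢ²` a DIAGONAL non-degenerate form (`‖cᵢ‖ = q^{-vᵢ}`). Following [Weil1964] Chap. II n° 27
(p. 175: "`g(f, M) = ∫_M χ(f(x)) dx`; … indépendant de `M` pourvu que `M ⊃ L′`, donc dès que `M` est assez
grand") we define

  `g(f, D) = ∫_D ψ(f(x)) dμ^⊗ι(x)`   (`gaussPi ψ μ c D`, `D ⊆ F^ι`)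

and prove:

* §0 the box lattices `𝔭^m × ⋯ × 𝔭^m` (`primePowPiBox`), their cosets `Πᵢ (aᵢ + 𝔭^ℓ)` (`piCoset`), and the
  second-degree character `ψ(Σ cᵢ xᵢ²) = Πᵢ ψ(cᵢ xᵢ²)` (`psiSqPi`);
* §1 BOXES: `g(f, 𝔭^m × ⋯ × 𝔭^m) = Πᵢ g(cᵢ, 𝔭^m)` (Fubini) — the integral form of n° 25 Prop. 3
  (`γ(f₁ ⊕ f₂) = γ(f₁) γ(f₂)`) for diagonal forms — and hence `= Πᵢ weilGauss(cᵢ)` on the common stable range;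
* §2 the COSET FORMULA `∫_{Π(aᵢ + 𝔭^ℓ)} ψ(f) = Πᵢ ψ(cᵢ aᵢ²) μ(𝔭^ℓ) [2 cᵢ aᵢ ∈ 𝔭^{d-ℓ}]` (Weil's (27) for the
  lattice `L = (𝔭^ℓ)^ι` on which `ψ ∘ f = 1`);
* §3 a compact subset of `F^ι` saturated by the open subgroup `(𝔭^ℓ)^ι` is a finite disjoint union of cosets
  `Π(aᵢ + 𝔭^ℓ)`, with the corresponding decomposition of set integrals;
* §4 **INDEPENDENCE OF THE LATTICE** (n° 27): for every compact `D ⊆ F^ι` stable under translation by `(𝔭^ℓ)^ι`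
  and containing the box `(𝔭^{m₀})^ι`, `(ℓ, m₀)` in the explicit admissible range, `g(f, D) = g(f, (𝔭^{m₀})^ι)`;
  consequently `g(f, D) = Πᵢ weilGauss(cᵢ)` for all lattices `D` large enough, so that the Weil index of the
  diagonal form is `Πᵢ γ(cᵢ)` whatever lattices are used (`exists_forall_gaussPi_eq_prod_weilGauss`).

NOT here (sequel files): the change of variables under `GL(F^ι)` (module `‖det‖`, n° 25 "formes
équivalentes") and the Weil index of a general non-degenerate quadratic form on `F^ι`.

## References

* [Weil1964] A. Weil, *Sur certains groupes d'opérateurs unitaires*, Acta Math. 111 (1964) 143–211, Chap. II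
  n° 25 Prop. 3 (p. 173), n° 27 (pp. 174–175).
-/

set_option autoImplicit false

noncomputable section

open MeasureTheory ValuativeRel Filter Topology Set
open scoped NNReal ENNReal Pointwise
open Literature.NumberTheory.GaloisRepresentations.IsNonarchimedeanLocalField
open Literature.NumberTheory.Automorphic

namespace Literature.NumberTheory.Weil1964

/-! ## §0 The second-degree character of a diagonal form; box lattices `(𝔭^m)^ι` and their cosets -/

section Character

variable {F : Type*} [Field F] {ι : Type*} (ψ : AddChar F Circle)

/-- an additive character maps finite sums to products (helper). [folklore] -/
private theorem addChar_map_sum (s : Finset ι) (g : ι → F) : (ψ (∑ i ∈ s, g i) : ℂ) = ∏ i ∈ s, (ψ (g i) : ℂ) := by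
  classical
  induction s using Finset.induction_on with
  | empty => simp
  | insert i s hi ih => rw [Finset.sum_insert hi, Finset.prod_insert hi, AddChar.map_add_eq_mul, Circle.coe_mul, ih]

variable [Fintype ι]

/-- the second-degree character `x ↦ ψ(Σᵢ cᵢ xᵢ²) = Πᵢ ψ(cᵢ xᵢ²)` of the diagonal form `f = Σ cᵢ xᵢ²` on `F^ι`,
written as the product of the one-variable characters. [cite: Weil1964, Chap. II n° 25, p. 173] -/
def psiSqPi (c : ι → F) (x : ι → F) : ℂ := ∏ i, psiSq ψ (c i) (x i)

/-- `Πᵢ ψ(cᵢ xᵢ²) = ψ(Σᵢ cᵢ xᵢ²)`. [cite: Weil1964, Chap. II n° 25, p. 173] -/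
theorem psiSqPi_apply (c x : ι → F) : psiSqPi ψ c x = ψ (∑ i, c i * x i ^ 2) := by
  rw [psiSqPi, addChar_map_sum]; rfl

/-- `|ψ(f(x))| = 1`. [cite: Weil1964, Chap. I n° 2, p. 146] -/
theorem norm_psiSqPi (c x : ι → F) : ‖psiSqPi ψ c x‖ = 1 := by
  rw [psiSqPi, norm_prod, Finset.prod_eq_one fun i _ => norm_psiSq ψ (c i) (x i)]

/-- **Weil's Gauss integral of the diagonal form over a subset `D ⊆ F^ι`**: `g(f, D) = ∫_D ψ(f(x)) dx` for the
product measure `μ^⊗ι` of a (Haar) measure `μ` on `F`. [cite: Weil1964, Chap. II n° 27, p. 175] -/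
def gaussPi [MeasurableSpace F] (μ : Measure F) (c : ι → F) (D : Set (ι → F)) : ℂ :=
  ∫ x in D, psiSqPi ψ c x ∂(Measure.pi fun _ : ι => μ)

/-- unfolding. [cite: Weil1964, Chap. II n° 27, p. 175] -/
theorem gaussPi_def [MeasurableSpace F] (μ : Measure F) (c : ι → F) (D : Set (ι → F)) :
    gaussPi ψ μ c D = ∫ x in D, psiSqPi ψ c x ∂(Measure.pi fun _ : ι => μ) := rfl

end Character

variable {F : Type*} [Field F] [ValuativeRel F] [TopologicalSpace F] [IsNonarchimedeanLocalField F]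
variable {ι : Type*}

section Box

variable (F ι) in
/-- the box lattice `𝔭^m × ⋯ × 𝔭^m ⊆ F^ι` (a "réseau" of `X = F^ι`: compact open `𝒪`-submodule).
[cite: Weil1964, Chap. II n° 27, p. 174] -/
def primePowPiBox (m : ℤ) : Set (ι → F) := Set.pi Set.univ fun _ => primePowBall F m

/-- membership in the box lattice. [cite: Weil1964, Chap. II n° 27, p. 174] -/
theorem mem_primePowPiBox_iff {m : ℤ} {x : ι → F} : x ∈ primePowPiBox F ι m ↔ ∀ i, x i ∈ primePowBall F m := by
  simp [primePowPiBox]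

/-- `0 ∈ (𝔭^m)^ι` (a lattice is a subgroup). [cite: Weil1964, Chap. II n° 27, p. 174] -/
theorem zero_mem_primePowPiBox (m : ℤ) : (0 : ι → F) ∈ primePowPiBox F ι m :=
  mem_primePowPiBox_iff.2 fun _ => zero_mem_primePowBall m

/-- `(𝔭^m)^ι` is closed under addition (a lattice is a subgroup). [cite: Weil1964, Chap. II n° 27, p. 174] -/
theorem add_mem_primePowPiBox {m : ℤ} {x y : ι → F} (hx : x ∈ primePowPiBox F ι m) (hy : y ∈ primePowPiBox F ι m) :
    x + y ∈ primePowPiBox F ι m :=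
  mem_primePowPiBox_iff.2 fun i => add_mem_primePowBall (mem_primePowPiBox_iff.1 hx i) (mem_primePowPiBox_iff.1 hy i)

/-- `(𝔭^m)^ι` is closed under negation (a lattice is a subgroup). [cite: Weil1964, Chap. II n° 27, p. 174] -/
theorem neg_mem_primePowPiBox {m : ℤ} {x : ι → F} (hx : x ∈ primePowPiBox F ι m) : -x ∈ primePowPiBox F ι m :=
  mem_primePowPiBox_iff.2 fun i => neg_mem_primePowBall (mem_primePowPiBox_iff.1 hx i)

/-- `x - y ∈ (𝔭^m)^ι` for `x, y ∈ (𝔭^m)^ι`. [cite: Weil1964, Chap. II n° 27, p. 174] -/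
theorem sub_mem_primePowPiBox {m : ℤ} {x y : ι → F} (hx : x ∈ primePowPiBox F ι m) (hy : y ∈ primePowPiBox F ι m) :
    x - y ∈ primePowPiBox F ι m := by
  rw [sub_eq_add_neg]; exact add_mem_primePowPiBox hx (neg_mem_primePowPiBox hy)

/-- the box lattices decrease. [cite: Weil1964, Chap. II n° 27, p. 174] -/
theorem primePowPiBox_antitone {m m' : ℤ} (h : m ≤ m') : primePowPiBox F ι m' ⊆ primePowPiBox F ι m :=
  fun _ hx => mem_primePowPiBox_iff.2 fun i => primePowBall_antitone h (mem_primePowPiBox_iff.1 hx i)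

/-- the box lattice is open ("réseau" = compact open `𝒪`-module). [cite: Weil1964, Chap. II n° 27, p. 174] -/
theorem isOpen_primePowPiBox [Finite ι] (m : ℤ) : IsOpen (primePowPiBox F ι m) :=
  isOpen_set_pi Set.finite_univ fun _ _ => isOpen_primePowBall m

/-- the box lattice is compact ("réseau" = compact open `𝒪`-module). [cite: Weil1964, Chap. II n° 27, p. 174] -/
theorem isCompact_primePowPiBox (m : ℤ) : IsCompact (primePowPiBox F ι m) :=
  isCompact_univ_pi fun _ => isCompact_primePowBall m

variable (F) in
/-- the coset `Πᵢ (aᵢ + 𝔭^ℓ)` of the box lattice `(𝔭^ℓ)^ι` through `a ∈ F^ι` (a class "suivant `L`").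
[cite: Weil1964, Chap. II n° 27, p. 174] -/
def piCoset (a : ι → F) (ℓ : ℤ) : Set (ι → F) := Set.pi Set.univ fun i => a i +ᵥ primePowBall F ℓ

/-- membership in a coset of the box lattice: `x ∈ Π(aᵢ + 𝔭^ℓ) ↔ ∀ i, xᵢ - aᵢ ∈ 𝔭^ℓ`.
[cite: Weil1964, Chap. II n° 27, p. 174] -/
theorem mem_piCoset_iff {a x : ι → F} {ℓ : ℤ} : x ∈ piCoset F a ℓ ↔ ∀ i, x i - a i ∈ primePowBall F ℓ := by
  simp [piCoset, mem_vadd_primePowBall_iff]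

/-- `x ∈ Π(aᵢ + 𝔭^ℓ) ↔ x - a ∈ (𝔭^ℓ)^ι`. [cite: Weil1964, Chap. II n° 27, p. 174] -/
theorem mem_piCoset_iff_sub_mem {a x : ι → F} {ℓ : ℤ} : x ∈ piCoset F a ℓ ↔ x - a ∈ primePowPiBox F ι ℓ := by
  rw [mem_piCoset_iff, mem_primePowPiBox_iff]; rfl

/-- `a ∈ Π(aᵢ + 𝔭^ℓ)`. [cite: Weil1964, Chap. II n° 27, p. 174] -/
theorem self_mem_piCoset (a : ι → F) (ℓ : ℤ) : a ∈ piCoset F a ℓ :=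
  mem_piCoset_iff.2 fun i => by rw [sub_self]; exact zero_mem_primePowBall ℓ

/-- `a + h ∈ Π(aᵢ + 𝔭^ℓ)` for `h ∈ (𝔭^ℓ)^ι`. [cite: Weil1964, Chap. II n° 27, p. 174] -/
theorem add_mem_piCoset {a h : ι → F} {ℓ : ℤ} (hh : h ∈ primePowPiBox F ι ℓ) : a + h ∈ piCoset F a ℓ :=
  mem_piCoset_iff_sub_mem.2 (by rwa [add_sub_cancel_left])

/-- every element of `Π(aᵢ + 𝔭^ℓ)` is `a + h` with `h ∈ (𝔭^ℓ)^ι`. [cite: Weil1964, Chap. II n° 27, p. 174] -/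
theorem exists_eq_add_of_mem_piCoset {a x : ι → F} {ℓ : ℤ} (hx : x ∈ piCoset F a ℓ) :
    ∃ h ∈ primePowPiBox F ι ℓ, x = a + h :=
  ⟨x - a, mem_piCoset_iff_sub_mem.1 hx, by rw [add_sub_cancel]⟩

/-- the coset through `0` is the box lattice itself. [cite: Weil1964, Chap. II n° 27, p. 174] -/
theorem piCoset_zero (ℓ : ℤ) : piCoset F (0 : ι → F) ℓ = primePowPiBox F ι ℓ := by
  ext x; rw [mem_piCoset_iff_sub_mem, sub_zero]

/-- two cosets of the box lattice that meet are equal. [cite: Weil1964, Chap. II n° 27, p. 174] -/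
theorem piCoset_eq_of_mem {ℓ : ℤ} {a u : ι → F} (hu : u ∈ piCoset F a ℓ) : piCoset F a ℓ = piCoset F u ℓ := by
  rw [mem_piCoset_iff_sub_mem] at hu
  ext x
  rw [mem_piCoset_iff_sub_mem, mem_piCoset_iff_sub_mem]
  constructor
  · intro hx
    have := sub_mem_primePowPiBox hx hu
    rwa [sub_sub_sub_cancel_right] at this
  · intro hx
    have := add_mem_primePowPiBox hx hu
    rwa [sub_add_sub_cancel] at this

/-- cosets of the box lattice are open. [cite: Weil1964, Chap. II n° 27, p. 174] -/
theorem isOpen_piCoset [Finite ι] (a : ι → F) (ℓ : ℤ) : IsOpen (piCoset F a ℓ) :=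
  isOpen_set_pi Set.finite_univ fun i _ => isOpen_vadd_primePowBall ℓ (a i)

/-- cosets of the box lattice are measurable (product `σ`-algebra; Weil integrates over the classes "suivant `L`").
[cite: Weil1964, Chap. II n° 27, p. 175] -/
theorem measurableSet_piCoset [MeasurableSpace F] [BorelSpace F] [Countable ι] (a : ι → F) (ℓ : ℤ) :
    MeasurableSet (piCoset F a ℓ) :=
  MeasurableSet.univ_pi fun i => measurableSet_vadd_primePowBall ℓ (a i)

/-- the box lattice is measurable (product `σ`-algebra; `g(f, M) = ∫_M …` is an integral over it).
[cite: Weil1964, Chap. II n° 27, p. 175] -/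
theorem measurableSet_primePowPiBox [MeasurableSpace F] [BorelSpace F] [Countable ι] (m : ℤ) :
    MeasurableSet (primePowPiBox F ι m) :=
  MeasurableSet.univ_pi fun _ => measurableSet_primePowBall m

end Box

/-- `F` is second countable (instance helper). [folklore] -/
private theorem secondCountable : SecondCountableTopology F := secondCountableTopology_localField F

/-- `F` is Hausdorff (instance helper). [folklore] -/
private theorem t2 : T2Space F :=
  (Literature.NumberTheory.GaloisRepresentations.IsNonarchimedeanLocalField.isLocalField F).toT2Space

variable [Fintype ι] [MeasurableSpace F] [BorelSpace F] (μ : Measure F) [μ.IsAddHaarMeasure] {ψ : AddChar F Circle}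

omit [BorelSpace F] in
/-- a Haar measure on `F` is `σ`-finite (instance helper: `F` is `σ`-compact). [folklore] -/
private theorem sigmaFinite_haar : SigmaFinite μ := by
  haveI : T2Space F :=
    (Literature.NumberTheory.GaloisRepresentations.IsNonarchimedeanLocalField.isLocalField F).toT2Space
  haveI : LocallyCompactSpace F :=
    (Literature.NumberTheory.GaloisRepresentations.IsNonarchimedeanLocalField.isLocalField F).toLocallyCompactSpace
  haveI : SecondCountableTopology F := secondCountable
  infer_instance

/-! ## §1 Boxes: `g(f, (𝔭^m)^ι) = Πᵢ g(cᵢ, 𝔭^m)` -/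

section Boxes

omit [BorelSpace F] in
/-- **product formula over a product set**: `∫_{Π sᵢ} Πᵢ ψ(cᵢ xᵢ²) dμ^⊗ι = Πᵢ ∫_{sᵢ} ψ(cᵢ x²) dμ` (Fubini).
[cite: Weil1964, Chap. II n° 25 Prop. 3, p. 173] -/
theorem setIntegral_pi_psiSqPi (c : ι → F) (s : ι → Set F) :
    ∫ x in Set.pi Set.univ s, psiSqPi ψ c x ∂(Measure.pi fun _ : ι => μ) = ∏ i, ∫ x in s i, psiSq ψ (c i) x ∂μ := by
  haveI := sigmaFinite_haar μ
  rw [show (Set.pi Set.univ s : Set (ι → F)) = Set.univ.pi fun i => s i from rfl, Measure.restrict_pi_pi]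
  exact integral_fintype_prod_eq_prod (fun i x => psiSq ψ (c i) x)

omit [BorelSpace F] in
/-- **`g(Σ cᵢ xᵢ², (𝔭^m)^ι) = Πᵢ g(cᵢ, 𝔭^m)`** (Fubini) — the integral form of `γ(f₁ ⊕ f₂) = γ(f₁)γ(f₂)` for the
box lattices. [cite: Weil1964, Chap. II n° 25 Prop. 3, p. 173] -/
theorem gaussPi_primePowPiBox (c : ι → F) (m : ℤ) :
    gaussPi ψ μ c (primePowPiBox F ι m) = ∏ i, gaussBall ψ μ (c i) m := by
  rw [gaussPi_def, primePowPiBox, setIntegral_pi_psiSqPi]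
  rfl

/-- hence on the common stable range (`2m ≤ d - vᵢ - 2v₂` for all `i`) `g(f, (𝔭^m)^ι) = Πᵢ g(cᵢ)` (the stable
values). [cite: Weil1964, Chap. II n° 27, p. 175] -/
theorem gaussPi_primePowPiBox_eq_prod_weilGauss {d : ℤ} (hd : ψ.HasConductorExp d) {c : ι → F} {v : ι → ℤ}
    (hc : ∀ i, normAbs F (c i) = (residueFieldCard F : ℝ≥0)⁻¹ ^ v i) {v₂ : ℤ}
    (h2 : normAbs F (2 : F) = (residueFieldCard F : ℝ≥0)⁻¹ ^ v₂) {m : ℤ} (hm : ∀ i, 2 * m ≤ d - v i - 2 * v₂) :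
    gaussPi ψ μ c (primePowPiBox F ι m) = ∏ i, weilGauss ψ μ (c i) := by
  rw [gaussPi_primePowPiBox]
  exact Finset.prod_congr rfl fun i _ => (weilGauss_eq_gaussBall μ hd (hc i) h2 (hm i)).symm

end Boxes

/-! ## §2 The coset formula in `F^ι` -/

section Coset

open scoped Classical in
/-- **coset formula for the diagonal form**: if `cᵢ 𝔭^{2ℓ} ⊆ 𝔭^d` for all `i` (i.e. `ψ ∘ f = 1` on `L = (𝔭^ℓ)^ι`)
then `∫_{Π(aᵢ + 𝔭^ℓ)} ψ(f) dμ^⊗ι = Πᵢ ψ(cᵢ aᵢ²) · μ(𝔭^ℓ) · [2 cᵢ aᵢ ∈ 𝔭^{d-ℓ}]` (the product of the one-variable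
coset formulas: Weil's (27) `Φ_L * (χ∘f) = m(L) φ_{L'} · (χ∘f)` for the lattice `L = (𝔭^ℓ)^ι`).
[cite: Weil1964, Chap. II n° 27, (27) p. 174] -/
theorem setIntegral_piCoset_psiSqPi {d : ℤ} (hd : ψ.HasConductorExp d) (c a : ι → F) {ℓ : ℤ}
    (hℓ : ∀ i, ∀ y ∈ primePowBall F ℓ, c i * y ^ 2 ∈ primePowBall F d) :
    ∫ x in piCoset F a ℓ, psiSqPi ψ c x ∂(Measure.pi fun _ : ι => μ) =
      ∏ i, (psiSq ψ (c i) (a i) *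
        (if 2 * c i * a i ∈ primePowBall F (d - ℓ) then (μ.real (primePowBall F ℓ) : ℂ) else 0)) := by
  rw [piCoset, setIntegral_pi_psiSqPi]
  exact Finset.prod_congr rfl fun i _ => setIntegral_vadd_primePowBall_psiSq μ hd (c i) (a i) (hℓ i)

/-- **the coset integral vanishes off the dual lattice**: under the hypothesis of the coset formula, if for
some `i` one has `2 cᵢ aᵢ ∉ 𝔭^{d-ℓ}`, then `∫_{Π(aᵢ + 𝔭^ℓ)} ψ(f) = 0` (`φ_{L'}(a) = 0`).
[cite: Weil1964, Chap. II n° 27, (27) p. 174] -/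
theorem setIntegral_piCoset_psiSqPi_eq_zero {d : ℤ} (hd : ψ.HasConductorExp d) (c a : ι → F) {ℓ : ℤ}
    (hℓ : ∀ i, ∀ y ∈ primePowBall F ℓ, c i * y ^ 2 ∈ primePowBall F d) {i : ι}
    (hi : 2 * c i * a i ∉ primePowBall F (d - ℓ)) :
    ∫ x in piCoset F a ℓ, psiSqPi ψ c x ∂(Measure.pi fun _ : ι => μ) = 0 := by
  classical
  rw [setIntegral_piCoset_psiSqPi μ hd c a hℓ]
  exact Finset.prod_eq_zero (Finset.mem_univ i) (by rw [if_neg hi, mul_zero])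

end Coset

/-! ## §3 Finite coset decompositions of compact saturated sets -/

section Decomposition

omit [MeasurableSpace F] [BorelSpace F] in
/-- **a compact subset of `F^ι` saturated by the open subgroup `(𝔭^ℓ)^ι` is a finite disjoint union of cosets
`Π(aᵢ + 𝔭^ℓ)`** (finite subcover by the open cosets through its points; cosets that meet coincide) — the finite set
`M'/L` of Weil's Gauss sum `g(f, M) = m(L) Σ_{x ∈ M'/L} χ(f(x))`. [cite: Weil1964, Chap. II n° 27, p. 175] -/
theorem exists_finset_piCosets {ℓ : ℤ} {K : Set (ι → F)} (hK : IsCompact K)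
    (hsat : ∀ x ∈ K, ∀ h ∈ primePowPiBox F ι ℓ, x + h ∈ K) :
    ∃ C : Finset (Set (ι → F)), (∀ B ∈ C, ∃ a ∈ K, B = piCoset F a ℓ) ∧
      (↑C : Set (Set (ι → F))).PairwiseDisjoint (fun B => B) ∧ K = ⋃ B ∈ C, B := by
  classical
  obtain ⟨A, hAK, hAfin, hA⟩ := hK.elim_finite_subcover_image (b := K)
    (c := fun a : ι → F => piCoset F a ℓ) (fun a _ => isOpen_piCoset a ℓ)
    (fun a ha => Set.mem_iUnion₂.2 ⟨a, ha, self_mem_piCoset a ℓ⟩)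
  obtain ⟨A', hA'⟩ := hAfin.exists_finset_coe
  subst hA'
  refine ⟨A'.image fun a => piCoset F a ℓ, ?_, ?_, ?_⟩
  · intro B hB
    obtain ⟨a, ha, rfl⟩ := Finset.mem_image.1 hB
    exact ⟨a, hAK (Finset.mem_coe.2 ha), rfl⟩
  · intro B hB B' hB' hne
    obtain ⟨a, -, rfl⟩ := Finset.mem_image.1 (Finset.mem_coe.1 hB)
    obtain ⟨a', -, rfl⟩ := Finset.mem_image.1 (Finset.mem_coe.1 hB')
    rw [Function.onFun, Set.disjoint_left]
    intro u hu hu'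
    exact hne ((piCoset_eq_of_mem hu).trans (piCoset_eq_of_mem hu').symm)
  · apply Set.Subset.antisymm
    · intro x hx
      obtain ⟨a, ha, hxa⟩ := Set.mem_iUnion₂.1 (hA hx)
      exact Set.mem_iUnion₂.2 ⟨piCoset F a ℓ, Finset.mem_image.2 ⟨a, Finset.mem_coe.1 ha, rfl⟩, hxa⟩
    · intro x hx
      obtain ⟨B, hB, hxB⟩ := Set.mem_iUnion₂.1 hx
      obtain ⟨a, ha, rfl⟩ := Finset.mem_image.1 hB
      obtain ⟨h, hh, rfl⟩ := exists_eq_add_of_mem_piCoset hxB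
      exact hsat a (hAK (Finset.mem_coe.2 ha)) h hh

omit [μ.IsAddHaarMeasure] in
/-- `ψ(f)` is integrable on every set of finite product measure (so `g(f, M)` is a genuine integral for every
lattice `M`). [cite: Weil1964, Chap. II n° 27, p. 175] -/
theorem integrableOn_psiSqPi (hψ : Continuous ψ) (c : ι → F) {D : Set (ι → F)}
    (hD : (Measure.pi fun _ : ι => μ) D ≠ ∞) :
    IntegrableOn (psiSqPi ψ c) D (Measure.pi fun _ : ι => μ) := by
  haveI : SecondCountableTopology F := secondCountable
  refine Measure.integrableOn_of_bounded (M := 1) hD ?_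
    (Eventually.of_forall fun x => (norm_psiSqPi ψ c x).le)
  have hcont : Continuous (psiSqPi ψ c) :=
    continuous_finsetProd _ fun i _ => (continuous_psiSq hψ (c i)).comp (continuous_apply i)
  exact hcont.aestronglyMeasurable

/-- **set integrals over a compact saturated set decompose along its cosets**: for `K` compact, saturated by
`(𝔭^ℓ)^ι`, `∫_K ψ(f) = Σ_{B ∈ C} ∫_B ψ(f)` for the finite disjoint family `C` of cosets covering `K`
(Weil: the sum over `M'/L`). [cite: Weil1964, Chap. II n° 27, p. 175] -/
theorem setIntegral_psiSqPi_eq_sum_of_cosets (hψ : Continuous ψ) (c : ι → F) {ℓ : ℤ} {K : Set (ι → F)}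
    (hK : IsCompact K) {C : Finset (Set (ι → F))} (hC : ∀ B ∈ C, ∃ a ∈ K, B = piCoset F a ℓ)
    (hCdisj : (↑C : Set (Set (ι → F))).PairwiseDisjoint (fun B => B)) (hKC : K = ⋃ B ∈ C, B) :
    ∫ x in K, psiSqPi ψ c x ∂(Measure.pi fun _ : ι => μ) =
      ∑ B ∈ C, ∫ x in B, psiSqPi ψ c x ∂(Measure.pi fun _ : ι => μ) := by
  haveI : SecondCountableTopology F := secondCountable
  haveI := sigmaFinite_haar μ
  have hKfin : (Measure.pi fun _ : ι => μ) K ≠ ∞ := (hK.measure_lt_top (μ := Measure.pi fun _ : ι => μ)).ne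
  conv_lhs => rw [hKC]
  refine integral_biUnion_finset C (fun B hB => ?_) hCdisj (fun B hB => ?_)
  · obtain ⟨a, -, rfl⟩ := hC B hB
    exact measurableSet_piCoset a ℓ
  · refine integrableOn_psiSqPi μ hψ c ((measure_mono ?_).trans_lt hKfin.lt_top).ne
    intro z hz
    rw [hKC]
    exact Set.mem_biUnion hB hz

end Decomposition

/-! ## §4 Independence of the lattice -/

section Independence

omit [Fintype ι] [MeasurableSpace F] [BorelSpace F] in
/-- off the box `(𝔭^{m₀})^ι` some coordinate is large: if `a ∉ (𝔭^{m₀})^ι` then for some `i`, `2 cᵢ aᵢ ∉ 𝔭^{d-ℓ}`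
provided `ℓ + m₀ ≤ d - v₂ - vᵢ` (bookkeeping of exponents: `‖2 cᵢ aᵢ‖ = q^{-(v₂ + vᵢ + k)}` with `k < m₀`).
[cite: Weil1964, Chap. II n° 27, p. 175] -/
theorem exists_two_mul_notMem_of_notMem_primePowPiBox {c : ι → F} {v : ι → ℤ}
    (hc : ∀ i, normAbs F (c i) = (residueFieldCard F : ℝ≥0)⁻¹ ^ v i) {v₂ : ℤ}
    (h2 : normAbs F (2 : F) = (residueFieldCard F : ℝ≥0)⁻¹ ^ v₂) {d ℓ m₀ : ℤ} (hm : ∀ i, ℓ + m₀ ≤ d - v₂ - v i)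
    {a : ι → F} (ha : a ∉ primePowPiBox F ι m₀) : ∃ i, 2 * c i * a i ∉ primePowBall F (d - ℓ) := by
  rw [mem_primePowPiBox_iff, not_forall] at ha
  obtain ⟨i, hi⟩ := ha
  refine ⟨i, fun hmem => hi ?_⟩
  have ha0 : a i ≠ 0 := by rintro h; exact hi (h ▸ zero_mem_primePowBall m₀)
  obtain ⟨k, hk⟩ := exists_normAbs_eq_inv_zpow ha0
  rw [mem_primePowBall_iff, map_mul, map_mul, h2, hc i, hk, ← zpow_add₀ inv_residueFieldCard_pos.ne',
    ← zpow_add₀ inv_residueFieldCard_pos.ne', inv_residueFieldCard_zpow_le_iff] at hmem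
  rw [mem_primePowBall_iff, hk, inv_residueFieldCard_zpow_le_iff]
  have := hm i
  omega

/-- **INDEPENDENCE OF THE LATTICE** (Weil: `g(f, M)` does not depend on the lattice `M ⊇ L'`): let `ψ` have
conductor exponent `d`, `‖cᵢ‖ = q^{-vᵢ}`, `‖2‖ = q^{-v₂}`, and let `ℓ, m₀` satisfy `d ≤ vᵢ + 2ℓ` for all `i`
(so `ψ ∘ f = 1` on `L = (𝔭^ℓ)^ι`), `ℓ + m₀ ≤ d - v₂ - vᵢ` for all `i` (so the dual lattice `L'` lies in the box
`(𝔭^{m₀})^ι`) and `m₀ ≤ ℓ`. Then for every compact `D ⊆ F^ι` stable under translations by `L` and containing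
`(𝔭^{m₀})^ι`: `g(f, D) = g(f, (𝔭^{m₀})^ι)` — the cosets of `L` in `D ∖ (𝔭^{m₀})^ι` contribute `0`.
[cite: Weil1964, Chap. II n° 27, p. 175] -/
theorem gaussPi_eq_gaussPi_primePowPiBox {d : ℤ} (hd : ψ.HasConductorExp d) {c : ι → F} {v : ι → ℤ}
    (hc : ∀ i, normAbs F (c i) = (residueFieldCard F : ℝ≥0)⁻¹ ^ v i) {v₂ : ℤ}
    (h2 : normAbs F (2 : F) = (residueFieldCard F : ℝ≥0)⁻¹ ^ v₂) {ℓ m₀ : ℤ} (hℓ : ∀ i, d ≤ v i + 2 * ℓ)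
    (hm : ∀ i, ℓ + m₀ ≤ d - v₂ - v i) (hmℓ : m₀ ≤ ℓ)
    {D : Set (ι → F)} (hDc : IsCompact D) (hDsat : ∀ x ∈ D, ∀ h ∈ primePowPiBox F ι ℓ, x + h ∈ D)
    (hDm : primePowPiBox F ι m₀ ⊆ D) :
    gaussPi ψ μ c D = gaussPi ψ μ c (primePowPiBox F ι m₀) := by
  haveI : SecondCountableTopology F := secondCountable
  haveI : T2Space F := t2
  haveI := sigmaFinite_haar μ
  have hψ : Continuous ψ := continuous_of_hasConductorExp hd
  -- triviality of `ψ ∘ f` on `L`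
  have hL : ∀ i, ∀ y ∈ primePowBall F ℓ, c i * y ^ 2 ∈ primePowBall F d := by
    intro i y hy
    have hb : c i ∈ primePowBall F (v i) := by rw [mem_primePowBall_iff, hc i]
    have h3 := mul_mem_primePowBall (mul_mem_primePowBall hb hy) hy
    rw [show c i * y * y = c i * y ^ 2 by ring] at h3
    exact primePowBall_antitone (by have := hℓ i; omega) h3
  -- the complement `K = D ∖ box m₀`
  set K : Set (ι → F) := D \ primePowPiBox F ι m₀ with hKdef
  have hKc : IsCompact K := hDc.diff (isOpen_primePowPiBox m₀)
  have hKsat : ∀ x ∈ K, ∀ h ∈ primePowPiBox F ι ℓ, x + h ∈ K := by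
    intro x hx h hh
    refine ⟨hDsat x hx.1 h hh, fun hxh => hx.2 ?_⟩
    have := sub_mem_primePowPiBox hxh (primePowPiBox_antitone hmℓ hh)
    rwa [add_sub_cancel_right] at this
  obtain ⟨C, hC, hCdisj, hKC⟩ := exists_finset_piCosets hKc hKsat
  -- each coset integral vanishes
  have hterm : ∀ B ∈ C, ∫ x in B, psiSqPi ψ c x ∂(Measure.pi fun _ : ι => μ) = 0 := by
    intro B hB
    obtain ⟨a, haK, rfl⟩ := hC B hB
    obtain ⟨i, hi⟩ := exists_two_mul_notMem_of_notMem_primePowPiBox hc h2 hm haK.2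
    exact setIntegral_piCoset_psiSqPi_eq_zero μ hd c a hL hi
  -- finiteness of measures
  have hDfin : (Measure.pi fun _ : ι => μ) D ≠ ∞ := (hDc.measure_lt_top (μ := Measure.pi fun _ : ι => μ)).ne
  -- assemble
  have hsplit : D = primePowPiBox F ι m₀ ∪ K := by rw [hKdef, Set.union_sdiff_cancel hDm]
  calc gaussPi ψ μ c D
      = ∫ x in primePowPiBox F ι m₀ ∪ K, psiSqPi ψ c x ∂(Measure.pi fun _ : ι => μ) := by rw [gaussPi_def, ← hsplit]
    _ = gaussPi ψ μ c (primePowPiBox F ι m₀) + ∫ x in K, psiSqPi ψ c x ∂(Measure.pi fun _ : ι => μ) := by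
        rw [gaussPi_def, setIntegral_union Set.disjoint_sdiff_right
            (hDc.measurableSet.diff (isOpen_primePowPiBox m₀).measurableSet)
          (integrableOn_psiSqPi μ hψ c ((measure_mono hDm).trans_lt hDfin.lt_top).ne)
          (integrableOn_psiSqPi μ hψ c ((measure_mono Set.sdiff_subset).trans_lt hDfin.lt_top).ne)]
    _ = gaussPi ψ μ c (primePowPiBox F ι m₀) +
          ∑ B ∈ C, ∫ x in B, psiSqPi ψ c x ∂(Measure.pi fun _ : ι => μ) := by
        rw [setIntegral_psiSqPi_eq_sum_of_cosets μ hψ c hKc hC hCdisj hKC]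
    _ = gaussPi ψ μ c (primePowPiBox F ι m₀) := by rw [Finset.sum_eq_zero hterm, add_zero]

/-- admissible `(ℓ, m₀)` exist, together with the stable-range condition `2 m₀ ≤ d - vᵢ - 2 v₂`. [folklore] -/
private theorem exists_admissible_pi (d v₂ : ℤ) (v : ι → ℤ) :
    ∃ ℓ m₀ : ℤ, (∀ i, d ≤ v i + 2 * ℓ) ∧ (∀ i, ℓ + m₀ ≤ d - v₂ - v i) ∧ m₀ ≤ ℓ ∧
      ∀ i, 2 * m₀ ≤ d - v i - 2 * v₂ := by
  classical
  -- a common bound `V` for all `|v i|`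
  obtain ⟨V, hV⟩ : ∃ V : ℤ, 0 ≤ V ∧ ∀ i, |v i| ≤ V := by
    refine ⟨∑ i, |v i|, Finset.sum_nonneg fun i _ => abs_nonneg (v i), fun i => ?_⟩
    exact Finset.single_le_sum (f := fun i => |v i|) (fun i _ => abs_nonneg (v i)) (Finset.mem_univ i)
  refine ⟨|d| + V, -(2 * (|d| + V + |v₂|)), fun i => ?_, fun i => ?_, ?_, fun i => ?_⟩
  · have := (abs_le.1 ((hV.2 i))).1
    cases abs_cases d <;> omega
  · have := (abs_le.1 ((hV.2 i))).2
    cases abs_cases d <;> cases abs_cases v₂ <;> omega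
  · have := hV.1
    cases abs_cases d <;> cases abs_cases v₂ <;> omega
  · have := (abs_le.1 ((hV.2 i))).2
    cases abs_cases d <;> cases abs_cases v₂ <;> omega

/-- **`g(f, D) = Πᵢ g(cᵢ)` for every lattice `D` large enough**: for `ψ` continuous non-trivial, all `cᵢ ≠ 0` and
`2 ≠ 0`, there are `ℓ` and `m₀ ≤ ℓ` such that every compact `D ⊇ (𝔭^{m₀})^ι` stable under `(𝔭^ℓ)^ι` has
`g(f, D) = Πᵢ weilGauss(cᵢ)`; so the Weil index of the diagonal form `Σ cᵢ xᵢ²` is `Πᵢ γ(cᵢ)` whatever lattices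
are used ("`γ(f) = γ(f₁) γ(f₂)`"). [cite: Weil1964, Chap. II n° 25 Prop. 3 and n° 27, pp. 173–175] -/
theorem exists_forall_gaussPi_eq_prod_weilGauss (hψ : ψ.IsContinuousNontrivial) {c : ι → F} (hc : ∀ i, c i ≠ 0)
    (htwo : (2 : F) ≠ 0) :
    ∃ ℓ m₀ : ℤ, m₀ ≤ ℓ ∧ ∀ D : Set (ι → F), IsCompact D → (∀ x ∈ D, ∀ h ∈ primePowPiBox F ι ℓ, x + h ∈ D) →
      primePowPiBox F ι m₀ ⊆ D → gaussPi ψ μ c D = ∏ i, weilGauss ψ μ (c i) := by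
  obtain ⟨d, hd⟩ := hψ.exists_hasConductorExp
  obtain ⟨v₂, hv₂⟩ := exists_normAbs_eq_inv_zpow htwo
  choose v hv using fun i => exists_normAbs_eq_inv_zpow (hc i)
  obtain ⟨ℓ, m₀, h1, h3, h5, h6⟩ := exists_admissible_pi d v₂ v
  refine ⟨ℓ, m₀, h5, fun D hDc hDsat hDm => ?_⟩
  rw [gaussPi_eq_gaussPi_primePowPiBox μ hd hv hv₂ h1 h3 h5 hDc hDsat hDm,
    gaussPi_primePowPiBox_eq_prod_weilGauss μ hd hv hv₂ h6]

/-- in particular the box integrals stabilise: `g(f, (𝔭^m)^ι) = Πᵢ g(cᵢ)` for all `m` small enough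
("dès que `M` est assez grand"). [cite: Weil1964, Chap. II n° 27, p. 175] -/
theorem eventually_gaussPi_primePowPiBox_eq_prod_weilGauss (hψ : ψ.IsContinuousNontrivial) {c : ι → F}
    (hc : ∀ i, c i ≠ 0) (htwo : (2 : F) ≠ 0) :
    ∀ᶠ m in atBot, gaussPi ψ μ c (primePowPiBox F ι m) = ∏ i, weilGauss ψ μ (c i) := by
  obtain ⟨ℓ, m₀, hmℓ, h⟩ := exists_forall_gaussPi_eq_prod_weilGauss μ hψ hc htwo
  filter_upwards [eventually_le_atBot m₀] with m hm
  exact h _ (isCompact_primePowPiBox m)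
    (fun x hx k hk => add_mem_primePowPiBox hx (primePowPiBox_antitone (hm.trans hmℓ) hk))
    (primePowPiBox_antitone hm)

end Independence

end Literature.NumberTheory.Weil1964
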